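import Summits.Ventures.PercRepro.Graph

/-!
# The star gadget as a multigraph — definitions (graph half of the star-gadget theorem, module 1)

The arithmetic half of mine-3's star-gadget theorem is in the tree (`PercRepro.StarGadget.F`,
`F'`, `F_nonneg`, `F'_nonneg`).  This module defines the GADGET GRAPH the polynomials `F` / `F'`
count on, so that the graph half («the (★)-slack of the gadget equals `F`, resp. `F'`») can be
stated and proved in the tree's vocabulary (`MultiGraph`, `Config`, `Conn`, `cluster`).

* marks `a b c` and the centre `x` are the four vertices `Fin 4` (`a = 0, b = 1, c = 2, x = 3`);
* a HUB is a vertex joined to `x` and to the marks of its type (`ab | ac | bc | abc`); there are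
  `p` hubs of type `ab`, `q` of type `ac`, `r` of type `bc`, `s` of type `abc`;
* the optional edge `c – x` is present iff `cx = true` (`F` counts the gadget with it, `F'` without).

Only definitions and the two facts about endpoints (every edge has a central endpoint; no edge
joins two hubs).  The local description of the bot configurations (`Local`, `Att`, `K`, `XR`)
is defined here and characterised in the next module.
-/

namespace PercRepro.StarGadgetGraph

/-- The four hub types of the star gadget: the set of marks a hub is joined to. -/
inductive HubType
  | ab | ac | bc | abc
  deriving DecidableEq, Fintype, Repr

/-- The marks of a hub type, as an increasing list of `Fin 3` (`a = 0`, `b = 1`, `c = 2`). -/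
def HubType.marks : HubType → List (Fin 3)
  | .ab => [0, 1]
  | .ac => [0, 2]
  | .bc => [1, 2]
  | .abc => [0, 1, 2]

/-- The hubs: `p` of type `ab`, `q` of type `ac`, `r` of type `bc`, `s` of type `abc`. -/
abbrev Hub (p q r s : ℕ) := Fin p ⊕ Fin q ⊕ Fin r ⊕ Fin s

/-- The type of a hub. -/
def hubType {p q r s : ℕ} : Hub p q r s → HubType
  | .inl _ => .ab
  | .inr (.inl _) => .ac
  | .inr (.inr (.inl _)) => .bc
  | .inr (.inr (.inr _)) => .abc

/-- The edges at a hub of type `T`: `none` is the edge to the centre `x`, `some i` the edge to the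
`i`-th mark of `T`. -/
abbrev HubEdge (T : HubType) := Option (Fin T.marks.length)

/-- The vertices: the four centrals (`a = 0, b = 1, c = 2, x = 3`) and the hubs. -/
abbrev V (p q r s : ℕ) := Fin 4 ⊕ Hub p q r s

/-- The mark `m` as a vertex. -/
def vm {p q r s : ℕ} (m : Fin 3) : V p q r s := .inl m.castSucc

/-- The centre `x` as a vertex. -/
def vx {p q r s : ℕ} : V p q r s := .inl 3

/-- The edges: the optional edge `c – x` (present iff `cx = true`) and, for every hub, its edges. -/
abbrev E (cx : Bool) (p q r s : ℕ) :=
  Fin (if cx then 1 else 0) ⊕ Σ h : Hub p q r s, HubEdge (hubType h)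

/-- **The star gadget** with `p, q, r, s` hubs of the four types and the edge `c – x` iff `cx`. -/
def starGadget (cx : Bool) (p q r s : ℕ) : MultiGraph (V p q r s) (E cx p q r s) where
  fst
    | .inl _ => vm 2
    | .inr ⟨_, none⟩ => vx
    | .inr ⟨h, some i⟩ => vm ((hubType h).marks.get i)
  snd
    | .inl _ => vx
    | .inr ⟨h, _⟩ => .inr h

/-! ### Projections of a configuration -/

variable {cx : Bool} {p q r s : ℕ}

/-- The state of the hub `h` in `ω`: which of its edges are open. -/
def hubState (ω : Config (E cx p q r s)) (h : Hub p q r s) : HubEdge (hubType h) → Bool :=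
  fun j => ω (.inr ⟨h, j⟩)

/-- The edge `x – h` is open. -/
def xOpen (ω : Config (E cx p q r s)) (h : Hub p q r s) : Prop := ω (.inr ⟨h, none⟩) = true

/-- Some edge `m – h` is open (false when `m` is not a mark of the type of `h`). -/
def markOpen (ω : Config (E cx p q r s)) (h : Hub p q r s) (m : Fin 3) : Prop :=
  ∃ i, (hubType h).marks.get i = m ∧ ω (.inr ⟨h, some i⟩) = true

/-- The edge `c – x` exists and is open. -/
def cxOpen (ω : Config (E cx p q r s)) : Prop := ∃ i, ω (.inl i) = true

/-- `xOpen` is decidable. -/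
instance (ω : Config (E cx p q r s)) (h : Hub p q r s) : Decidable (xOpen ω h) := by
  unfold xOpen; infer_instance

/-- `markOpen` is decidable. -/
instance (ω : Config (E cx p q r s)) (h : Hub p q r s) (m : Fin 3) : Decidable (markOpen ω h m) := by
  unfold markOpen; infer_instance

/-- `cxOpen` is decidable. -/
instance (ω : Config (E cx p q r s)) : Decidable (cxOpen ω) := by
  unfold cxOpen; infer_instance

/-! ### The centrals and the two endpoint facts -/

/-- The centrals `{a, b, c, x}`. -/
def Cen (p q r s : ℕ) : Set (V p q r s) := Set.range Sum.inl

/-- The marks are central. -/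
theorem vm_mem_cen (m : Fin 3) : vm m ∈ Cen p q r s := ⟨m.castSucc, rfl⟩

/-- The centre is central. -/
theorem vx_mem_cen : vx ∈ Cen p q r s := ⟨3, rfl⟩

/-- A hub is not central. -/
theorem inr_not_mem_cen (h : Hub p q r s) : (Sum.inr h : V p q r s) ∉ Cen p q r s := by
  rintro ⟨i, hi⟩; cases hi

/-- **Fact G1**: every edge of the star gadget has a central endpoint. -/
theorem fst_mem_cen_or_snd_mem_cen (e : E cx p q r s) :
    (starGadget cx p q r s).fst e ∈ Cen p q r s ∨ (starGadget cx p q r s).snd e ∈ Cen p q r s := by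
  rcases e with i | ⟨h, j⟩
  · exact Or.inl (vm_mem_cen 2)
  · rcases j with _ | i
    · exact Or.inl vx_mem_cen
    · exact Or.inl (vm_mem_cen _)

/-- The first endpoint of every edge is central (the gadget is a star around the centrals). -/
theorem fst_mem_cen (e : E cx p q r s) : (starGadget cx p q r s).fst e ∈ Cen p q r s := by
  rcases e with i | ⟨h, j⟩
  · exact vm_mem_cen 2
  · rcases j with _ | i
    · exact vx_mem_cen
    · exact vm_mem_cen _

/-- No edge joins two hubs: the second endpoint of a hub edge is the hub itself, and its first
endpoint is central. -/
theorem snd_inr (h : Hub p q r s) (j : HubEdge (hubType h)) :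
    (starGadget cx p q r s).snd (.inr ⟨h, j⟩) = Sum.inr h := rfl

/-! ### The local description of the bot configurations (characterised in the next module) -/

/-- `Local ω`: (i) at most one open mark edge per hub; (ii) all hubs with an open `x`-edge carry
the same open mark (if any); (iii) if `c – x` is open, the hubs with an open `x`-edge carry no
open mark edge except to `c`. -/
def Local (ω : Config (E cx p q r s)) : Prop :=
  (∀ h m m', markOpen ω h m → markOpen ω h m' → m = m') ∧
  (∀ h h' m m', xOpen ω h → xOpen ω h' → markOpen ω h m → markOpen ω h' m' → m = m') ∧
  (cxOpen ω → ∀ h m, xOpen ω h → markOpen ω h m → m = 2)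

/-- `Att ω m`: the centre `x` attaches to the mark `m` — through the edge `c – x` (`m = c`) or
through a hub with open `x`-edge and open `m`-edge. -/
def Att (ω : Config (E cx p q r s)) (m : Fin 3) : Prop :=
  (m = 2 ∧ cxOpen ω) ∨ ∃ h, xOpen ω h ∧ markOpen ω h m

/-- The candidate open cluster of the mark `m`: the mark, the hubs hanging from it alone, and —
if `x` attaches to `m` — the centre with all hubs hanging from the centre. -/
def K (ω : Config (E cx p q r s)) (m : Fin 3) : Set (V p q r s) :=
  {vm m} ∪ {v | ∃ h, v = Sum.inr h ∧ ¬ xOpen ω h ∧ markOpen ω h m} ∪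
    {v | Att ω m ∧ (v = vx ∨ ∃ h, v = Sum.inr h ∧ xOpen ω h)}

/-- The candidate open cluster of the centre when it attaches to no mark: `x` and the hubs with
open `x`-edge. -/
def XR (ω : Config (E cx p q r s)) : Set (V p q r s) :=
  {vx} ∪ {v | ∃ h, v = Sum.inr h ∧ xOpen ω h}

/-- `Att` is decidable. -/
instance (ω : Config (E cx p q r s)) (m : Fin 3) : Decidable (Att ω m) := by
  unfold Att; infer_instance

/-- `Local` is decidable. -/
instance (ω : Config (E cx p q r s)) : Decidable (Local ω) := by
  unfold Local; infer_instance

end PercRepro.StarGadgetGraph
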